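import Summits.Ventures.PercRepro.S1SpreadSlackZeroBase

/-!
# PercRepro — THE NULLITY OF A PROPER SUBSET OF A COLOOP-FREE MATROID (p1, gen 37)

Tools for the low-rank set counts of the nullity-`4` contraction `N = M ／ W` of the case `ν = 4` of the cell `(13, 8)`
(p7's ν = 4 program; `N` is loopless, coloop-free, nullity `4` on `12` points). Writing `rk X := (M.eRk X).toNat`:
* **`ncard_add_eRk_le_of_subset`** — relative monotonicity of the nullity: `Y ⊆ X ⊆ E ⇒ |Y| + rk X ≤ |X| + rk Y`;
* **`eRk_union_eq_of_subset_closure`** — `X ⊆ cl Z ⇒ rk (X ∪ Z) = rk Z` (a set inside a closure adds no rank);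
* **`ncard_add_one_le_eRk_toNat_add_of_ssubset`** (THE KEY): in a coloop-free matroid of nullity `d`, EVERY PROPER SUBSET
  `X ⊊ E` has nullity `≤ d − 1`: `|X| + 1 ≤ rk X + d` (if `|X| = rk X + d` then `E ∖ X` is independent and skew to `X`,
  so each of its points is a coloop);
* **`ncard_add_one_le_eRk_toNat_add_of_not_isColoop`** — the same from a single non-coloop `x ∈ E ∖ X`;
* **`eRk_le_one_of_subset_closure_singleton`** — a set inside `cl {x}` has rank `≤ 1`;
* **`ncard_ground_eq_eRk_toNat_add`** — `|E| = rk E + d` in natural numbers.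
Nothing about any cell is claimed. Axioms: standard.
-/

open scoped Matroid

namespace PercRepro

namespace S1CF

open Set

variable {α : Type}

/-- **Relative monotonicity of the nullity**: for `Y ⊆ X ⊆ E`, `|Y| + rk X ≤ |X| + rk Y`. -/
theorem ncard_add_eRk_le_of_subset (M : Matroid α) [M.Finite] {X Y : Set α} (hX : X ⊆ M.E)
    (hYX : Y ⊆ X) : Y.ncard + (M.eRk X).toNat ≤ X.ncard + (M.eRk Y).toNat := by
  have hY : Y ⊆ M.E := hYX.trans hX
  have hXfin : X.Finite := M.ground_finite.subset hX
  have h1 : M.eRk X ≤ M.eRk Y + (X \ Y).encard := by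
    have := M.eRk_union_le_eRk_add_encard Y (X \ Y)
    rwa [union_sdiff_cancel hYX] at this
  rw [← S1.coe_toNat_eRk M hX, ← S1.coe_toNat_eRk M hY, ← (hXfin.subset sdiff_subset).cast_ncard_eq] at h1
  have h2 : (M.eRk X).toNat ≤ (M.eRk Y).toNat + (X \ Y).ncard := by exact_mod_cast h1
  have h3 := Set.ncard_sdiff_add_ncard_of_subset hYX hXfin
  omega

/-- A set inside the closure of `Z` adds no rank: `X ⊆ cl Z ⇒ rk (X ∪ Z) = rk Z`. -/
theorem eRk_union_eq_of_subset_closure (M : Matroid α) {X Z : Set α} (hZ : Z ⊆ M.E)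
    (hX : X ⊆ M.closure Z) : M.eRk (X ∪ Z) = M.eRk Z := by
  apply le_antisymm
  · have h : X ∪ Z ⊆ M.closure Z := union_subset hX (M.subset_closure Z hZ)
    calc M.eRk (X ∪ Z) ≤ M.eRk (M.closure Z) := M.eRk_mono h
      _ = M.eRk Z := M.eRk_closure_eq Z
  · exact M.eRk_mono subset_union_right

/-- The same key inequality from one non-coloop outside `X`: if `x ∈ E ∖ X` is not a coloop then `|X| + 1 ≤ rk X + d`. -/
theorem ncard_add_one_le_eRk_toNat_add_of_not_isColoop (M : Matroid α) [M.Finite] {d : ℕ}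
    (hd : M.E.encard = M.eRank + d) {X : Set α} (hX : X ⊆ M.E) {x : α} (hxE : x ∈ M.E) (hxX : x ∉ X)
    (hx : ¬ M.IsColoop x) : X.ncard + 1 ≤ (M.eRk X).toNat + d := by
  have hEfin : M.E.Finite := M.ground_finite
  have hxcl : x ∈ M.closure (M.E \ {x}) := by
    rw [Matroid.isColoop_iff_notMem_closure_compl hxE] at hx
    push Not at hx
    exact hx
  have hrk : M.eRk M.E = M.eRk (M.E \ {x}) := by
    have h1 : M.E ⊆ M.closure (M.E \ {x}) := by
      intro y hy
      by_cases hyx : y = x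
      · subst hyx; exact hxcl
      · exact M.subset_closure (M.E \ {x}) sdiff_subset ⟨hy, hyx⟩
    apply le_antisymm
    · calc M.eRk M.E ≤ M.eRk (M.closure (M.E \ {x})) := M.eRk_mono h1
        _ = M.eRk (M.E \ {x}) := M.eRk_closure_eq _
    · exact M.eRk_mono sdiff_subset
  have hXsub : X ⊆ M.E \ {x} := subset_sdiff_singleton hX hxX
  have h2 : M.eRk (M.E \ {x}) ≤ M.eRk X + ((M.E \ {x}) \ X).encard := by
    have := M.eRk_union_le_eRk_add_encard X ((M.E \ {x}) \ X)
    rwa [union_sdiff_cancel hXsub] at this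
  rw [← hrk, ← S1.coe_toNat_eRk M (subset_refl M.E), ← S1.coe_toNat_eRk M hX,
    ← (hEfin.subset (sdiff_subset.trans sdiff_subset)).cast_ncard_eq] at h2
  have h3 : (M.eRk M.E).toNat ≤ (M.eRk X).toNat + ((M.E \ {x}) \ X).ncard := by exact_mod_cast h2
  have h4 := Set.ncard_sdiff_add_ncard_of_subset hXsub (hEfin.subset sdiff_subset)
  have h5 : (M.E \ {x}).ncard + 1 = M.E.ncard := by
    rw [Set.ncard_sdiff_singleton_add_one hxE hEfin]
  have h6 : M.E.ncard = (M.eRk M.E).toNat + d := by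
    rw [Matroid.eRank_def, ← S1.coe_toNat_eRk M (subset_refl M.E), ← hEfin.cast_ncard_eq] at hd
    exact_mod_cast hd
  omega

/-- **Coloop-free ⇒ every proper subset has nullity `≤ d − 1`**: `|X| + 1 ≤ rk X + d` for `X ⊊ E` when
`|E| = rank + d` and no element is a coloop. -/
theorem ncard_add_one_le_eRk_toNat_add_of_ssubset (M : Matroid α) [M.Finite] {d : ℕ}
    (hd : M.E.encard = M.eRank + d) (hK : ∀ e, ¬ M.IsColoop e) {X : Set α} (hX : X ⊆ M.E)
    (hne : X ≠ M.E) : X.ncard + 1 ≤ (M.eRk X).toNat + d := by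
  obtain ⟨x, hxE, hxX⟩ : ∃ x ∈ M.E, x ∉ X := by
    by_contra h
    push Not at h
    exact hne (hX.antisymm h)
  exact ncard_add_one_le_eRk_toNat_add_of_not_isColoop M hd hX hxE hxX (hK x)

/-- A set inside `cl {x}` has rank `≤ 1`. -/
theorem eRk_le_one_of_subset_closure_singleton (M : Matroid α) {X : Set α} {x : α}
    (hX : X ⊆ M.closure {x}) : M.eRk X ≤ 1 :=
  calc M.eRk X ≤ M.eRk (M.closure {x}) := M.eRk_mono hX
    _ = M.eRk {x} := M.eRk_closure_eq _
    _ ≤ 1 := M.eRk_singleton_le x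

/-- The ground set of a matroid of nullity `d` with `|E| = n` has rank `n − d` (natural-number form). -/
theorem ncard_ground_eq_eRk_toNat_add (M : Matroid α) [M.Finite] {d : ℕ}
    (hd : M.E.encard = M.eRank + d) : M.E.ncard = (M.eRk M.E).toNat + d := by
  have hEfin : M.E.Finite := M.ground_finite
  rw [Matroid.eRank_def, ← S1.coe_toNat_eRk M (subset_refl M.E), ← hEfin.cast_ncard_eq] at hd
  exact_mod_cast hd

end S1CF

end PercRepro
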